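import Mathlib.Analysis.MeanInequalitiesPow
import Mathlib.Analysis.SpecialFunctions.Pow.Deriv
import Mathlib.Analysis.Calculus.Deriv.MeanValue
import Mathlib.MeasureTheory.Function.StronglyMeasurable.Lemmas
import Mathlib.MeasureTheory.Function.LpSeminorm.Basic
import Literature.Analysis.FunctionSpaces.TorusLatticeCellTranslation
import HarnessLib

/-!
# The improved Hölder inequality (`L^p` decorrelation) on the flat torus `T^d`

Analysis/FunctionSpaces file. PROVED here: the "improved Hölder inequality" of
Modena–Székelyhidi (Ann. PDE 4 (2018) = arXiv:1712.03867, §2.1, **Lemma 2.1**), which is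
**Lemma 3** of T. Luo, E. S. Titi, Calc. Var. PDE 59 (2020) = arXiv:1808.07595, §3.4
("Let `f, g ∈ C^∞(𝕋³)`, and `g` is `(𝕋/N)³` periodic, `N ∈ ℕ`. Then for `1 ≤ p ≤ ∞`,
`‖fg‖_{L^p} ≤ ‖f‖_{L^p}‖g‖_{L^p} + C_p N^{-1/p} ‖f‖_{C¹} ‖g‖_{L^p}`"), the `L^p` decorrelation
device of the intermittent convex-integration schemes (a variant of Buckmaster–Vicol, Ann. of
Math. 189 (2019), Lemma 3.7). Modena–Székelyhidi print it as: "Let `λ ∈ ℕ` and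
`f, g : 𝕋^d → ℝ` be smooth functions. Then for every `p ∈ [1, ∞]`,
`| ‖f g_λ‖_{L^p} - ‖f‖_{L^p}‖g‖_{L^p} | ≤ C_p λ^{-1/p} ‖f‖_{C¹} ‖g‖_{L^p}`" with
`g_λ(x) = g(λx)`; their proof (division of `𝕋^d` into `λ^d` cubes of edge `1/λ`, on each of
which `∫_Q |g_λ|^p = λ^{-d} ‖g‖^p_{L^p}` and `| |f(x)|^p - |f(y)|^p | ≤ C_p λ⁻¹ ‖f‖^p_{C¹}`) is
the one formalised.

## The statement proved (read before comparing with the printed one)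

On the unit torus `T^d = (ℝ/ℤ)^d` with its probability Haar measure, for a finite exponent
`1 ≤ p < ∞`, an integer `N ≥ 1`, a function `g : T^d → F` (any real normed space) which is
a.e.-strongly measurable and invariant under the finer lattice `(1/N)ℤ^d`
(`g(x + κ/N) = g(x)` for all `κ ∈ ℤ^d` — this is "`g` is `(𝕋/N)^d`-periodic", and covers
`g_λ = g(λ·)`), and a function `f : T^d → ℝ` with `|f| ≤ M` whose lift to `ℝ^d` is
`L`-Lipschitz (for `f ∈ C¹` one takes `M = ‖f‖_{C⁰}`, `L = ‖∇f‖_{C⁰}`, so that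
`max(M, L) ≤ ‖f‖_{C¹}`):

* `Torus.lintegral_rpow_smul_le_of_latticeInvariant` — the `p`-th power form
  `∫ |f|^p ‖g‖^p ≤ (∫ |f|^p + p M^{p-1} L √d / N) ∫ ‖g‖^p` (Modena–Székelyhidi's
  `| ‖fg_λ‖^p_p - ‖f‖^p_p‖g‖^p_p | ≤ C_p λ⁻¹ ‖f‖^p_{C¹} ‖g‖^p_p`, upper half);
* `Torus.eLpNorm_smul_le_of_latticeInvariant` — **the improved Hölder inequality**
  `‖f g‖_{L^p} ≤ ‖f‖_{L^p} ‖g‖_{L^p} + (p M^{p-1} L √d / N)^{1/p} ‖g‖_{L^p}`;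
* `Torus.eLpNorm_smul_le_of_latticeInvariant'` — the printed shape
  `‖f g‖_{L^p} ≤ ‖f‖_{L^p} ‖g‖_{L^p} + C N^{-1/p} K ‖g‖_{L^p}` with `C = (p √d)^{1/p}` and any
  `K ≥ max(M, L)` (e.g. `K = ‖f‖_{C¹}`).

Only the upper inequality (the one used downstream, Luo–Titi (3.12)) is formalised, and only
finite `p` (at `p = ∞` the printed statement is Hölder's inequality itself). The constant is
explicit. The lower-semicontinuity half `‖f‖_p‖g‖_p - … ≤ ‖fg_λ‖_p` of Lemma 2.1 is not here.

## Proof devices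

* (`TorusLatticeCellTranslation`) the cell `Q_κ` of mesh `1/N` is the translate of `Q_0` by
  `κ/N` and Lebesgue measure is translation invariant, so for a `(1/N)ℤ^d`-invariant integrand
  all `N^d` cell integrals agree and each is `N^{-d}` times the integral over the torus
  (`Torus.card_mul_setLIntegral_cell_eq_lintegral`);
* (here) `Torus.rpow_le_rpow_add` — `t^p ≤ s^p + p M^{p-1} |t - s|` for `0 ≤ s, t ≤ M`,
  `p ≥ 1` (mean value theorem), whence the cellwise oscillation bound
  `vol(Q) · sup_Q |f∘proj|^p ≤ ∫_Q |f∘proj|^p + vol(Q) · p M^{p-1} L √d/N`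
  (`Torus.volume_mul_enorm_rpow_le`).

## References

* S. Modena, L. Székelyhidi Jr., *Non-uniqueness for the transport equation with Sobolev vector
  fields*, Ann. PDE 4 (2018), Paper No. 18 = arXiv:1712.03867, §2.1 Lemma 2.1 and its proof.
  [`ModenaSzekelyhidi2018`]
* T. Luo, E. S. Titi, Calc. Var. PDE 59 (2020) = arXiv:1808.07595, §3.4 Lemma 3. [`LuoTiti2020`]
* T. Buckmaster, V. Vicol, Ann. of Math. 189 (2019), Lemma 3.7 and App. A.
  [`BuckmasterVicol2019AnnMath`]
-/

noncomputable section

open MeasureTheory Set Filter Function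
open scoped ENNReal NNReal

namespace Literature.Analysis.FunctionSpaces

namespace Torus

variable {d : Type*} [Fintype d]

/-! ## A real-variable inequality: `t^p ≤ s^p + p M^{p-1} |t - s|` -/

/-- For `p ≥ 1` and `0 ≤ s, t ≤ M`: `t^p ≤ s^p + p M^{p-1} |t - s|` (mean value theorem for
`u ↦ u^p` between `s` and `t`; Modena–Székelyhidi: "`| |f(x)|^p - |f(y)|^p | ≤
C_p ‖f‖^{p-1}_{C⁰} ‖∇f‖_{C⁰} λ⁻¹`"). [folklore] -/
theorem rpow_le_rpow_add {p s t M : ℝ} (hp : 1 ≤ p) (hs : 0 ≤ s) (ht : 0 ≤ t) (hsM : s ≤ M)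
    (htM : t ≤ M) : t ^ p ≤ s ^ p + p * M ^ (p - 1) * |t - s| := by
  have hp0 : 0 ≤ p := zero_le_one.trans hp
  have hM : 0 ≤ M := hs.trans hsM
  have hextra : 0 ≤ p * M ^ (p - 1) * |t - s| := by positivity
  rcases le_or_gt t s with hts | hst
  · exact (Real.rpow_le_rpow ht hts hp0).trans (le_add_of_nonneg_right hextra)
  · -- mean value theorem on `[s, t]`
    obtain ⟨c, hc, hc'⟩ := exists_hasDerivAt_eq_slope (fun u : ℝ => u ^ p)
      (fun u => p * u ^ (p - 1)) hst
      (fun u _ => (Real.hasDerivAt_rpow_const (Or.inr hp)).continuousAt.continuousWithinAt)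
      (fun u _ => Real.hasDerivAt_rpow_const (Or.inr hp))
    have hne : t - s ≠ 0 := sub_ne_zero.mpr hst.ne'
    have heq : t ^ p - s ^ p = p * c ^ (p - 1) * (t - s) := by
      have := hc'
      field_simp at this
      linarith
    have hc0 : 0 ≤ c := hs.trans hc.1.le
    have hcM : c ≤ M := hc.2.le.trans htM
    have hcp : c ^ (p - 1) ≤ M ^ (p - 1) := Real.rpow_le_rpow hc0 hcM (by linarith)
    rw [abs_of_pos (sub_pos.mpr hst)]
    have : p * c ^ (p - 1) * (t - s) ≤ p * M ^ (p - 1) * (t - s) :=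
      mul_le_mul_of_nonneg_right (mul_le_mul_of_nonneg_left hcp hp0) (sub_pos.mpr hst).le
    linarith

/-! ## The cellwise oscillation bound for `|f ∘ proj|^p` -/

section Oscillation

variable {N : ℕ} {p M L : ℝ} {f : UnitAddTorus d → ℝ}

/-- Pointwise: `|f(proj y)|^p ≤ |f(proj y')|^p + p M^{p-1} L ‖y - y'‖` for `|f| ≤ M` with
`L`-Lipschitz lift. [folklore] -/
theorem abs_rpow_le_abs_rpow_add (hp : 1 ≤ p) (hfM : ∀ x, |f x| ≤ M)
    (hfL : ∀ y y' : EuclideanSpace ℝ d, |f (proj y) - f (proj y')| ≤ L * ‖y - y'‖)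
    (y y' : EuclideanSpace ℝ d) :
    |f (proj y)| ^ p ≤ |f (proj y')| ^ p + p * M ^ (p - 1) * (L * ‖y - y'‖) := by
  have h := rpow_le_rpow_add hp (abs_nonneg (f (proj y'))) (abs_nonneg (f (proj y))) (hfM _) (hfM _)
  have hdiff : |(|f (proj y)| - |f (proj y')|)| ≤ L * ‖y - y'‖ :=
    (abs_abs_sub_abs_le_abs_sub _ _).trans (hfL y y')
  have hp0 : 0 ≤ p := zero_le_one.trans hp
  have hM : 0 ≤ M := (abs_nonneg _).trans (hfM (proj y))
  have : p * M ^ (p - 1) * |(|f (proj y)| - |f (proj y')|)| ≤ p * M ^ (p - 1) * (L * ‖y - y'‖) :=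
    mul_le_mul_of_nonneg_left hdiff (by positivity)
  linarith

/-- The same in `ℝ≥0∞` with the oscillation over a cell of mesh `1/N`: for `y, y'` in one
cell, `‖f(proj y)‖ₑ^p ≤ ‖f(proj y')‖ₑ^p + E`, `E = p M^{p-1} L √d / N`. [folklore] -/
theorem enorm_rpow_le_of_mem_cell (hN : 0 < N) (hp : 1 ≤ p) (hL : 0 ≤ L) (hfM : ∀ x, |f x| ≤ M)
    (hfL : ∀ y y' : EuclideanSpace ℝ d, |f (proj y) - f (proj y')| ≤ L * ‖y - y'‖)
    {κ : d → ℤ} {y y' : EuclideanSpace ℝ d} (hy : y ∈ latticeCell N κ) (hy' : y' ∈ latticeCell N κ) :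
    ‖f (proj y)‖ₑ ^ p ≤ ‖f (proj y')‖ₑ ^ p +
      ENNReal.ofReal (p * M ^ (p - 1) * L * (Real.sqrt (Fintype.card d) / N)) := by
  have hp0 : 0 ≤ p := zero_le_one.trans hp
  have hM : 0 ≤ M := (abs_nonneg _).trans (hfM (proj y))
  have hdist : ‖y - y'‖ ≤ Real.sqrt (Fintype.card d) / N := norm_sub_le_of_mem_latticeCell hN hy' hy
  have h1 := abs_rpow_le_abs_rpow_add hp hfM hfL y y'
  have h2 : p * M ^ (p - 1) * (L * ‖y - y'‖) ≤ p * M ^ (p - 1) * L * (Real.sqrt (Fintype.card d) / N) := by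
    rw [mul_assoc (p * M ^ (p - 1)) L]
    exact mul_le_mul_of_nonneg_left (mul_le_mul_of_nonneg_left hdist hL) (by positivity)
  rw [Real.enorm_eq_ofReal_abs, Real.enorm_eq_ofReal_abs,
    ENNReal.ofReal_rpow_of_nonneg (abs_nonneg _) hp0, ENNReal.ofReal_rpow_of_nonneg (abs_nonneg _) hp0,
    ← ENNReal.ofReal_add (by positivity) (by positivity)]
  exact ENNReal.ofReal_le_ofReal (h1.trans (by linarith))

/-- **Cellwise oscillation bound**: `vol(Q) · ‖f(proj y)‖ₑ^p ≤ ∫_Q |f∘proj|^p + vol(Q) · E` for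
every `y ∈ Q` (integrate the pointwise bound over `y' ∈ Q`). [folklore] -/
theorem volume_mul_enorm_rpow_le (hN : 0 < N) (hp : 1 ≤ p) (hL : 0 ≤ L) (hfM : ∀ x, |f x| ≤ M)
    (hfL : ∀ y y' : EuclideanSpace ℝ d, |f (proj y) - f (proj y')| ≤ L * ‖y - y'‖)
    {κ : d → ℤ} {y : EuclideanSpace ℝ d} (hy : y ∈ latticeCell N κ) :
    volume (latticeCell N κ) * ‖f (proj y)‖ₑ ^ p ≤
      (∫⁻ y' in latticeCell N κ, ‖f (proj y')‖ₑ ^ p) +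
        volume (latticeCell N κ) *
          ENNReal.ofReal (p * M ^ (p - 1) * L * (Real.sqrt (Fintype.card d) / N)) := by
  set E := ENNReal.ofReal (p * M ^ (p - 1) * L * (Real.sqrt (Fintype.card d) / N)) with hE
  calc volume (latticeCell N κ) * ‖f (proj y)‖ₑ ^ p
      = ∫⁻ _ in latticeCell N κ, ‖f (proj y)‖ₑ ^ p := by rw [setLIntegral_const, mul_comm]
    _ ≤ ∫⁻ y' in latticeCell N κ, (‖f (proj y')‖ₑ ^ p + E) :=
        setLIntegral_mono' measurableSet_latticeCell fun y' hy' =>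
          enorm_rpow_le_of_mem_cell hN hp hL hfM hfL hy hy'
    _ = (∫⁻ y' in latticeCell N κ, ‖f (proj y')‖ₑ ^ p) + volume (latticeCell N κ) * E := by
        rw [lintegral_add_right _ measurable_const, setLIntegral_const, mul_comm E]

end Oscillation

/-! ## The improved Hölder inequality -/

section Main

variable [DecidableEq d] {F : Type*} [NormedAddCommGroup F] [NormedSpace ℝ F]
variable {N : ℕ} {p M L : ℝ} {f : UnitAddTorus d → ℝ} {g : UnitAddTorus d → F}

omit [DecidableEq d] in
/-- A function with Lipschitz lift is continuous. [folklore] -/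
theorem continuous_of_lipschitz_lift (hL : 0 ≤ L)
    (hfL : ∀ y y' : EuclideanSpace ℝ d, |f (proj y) - f (proj y')| ≤ L * ‖y - y'‖) :
    Continuous f := by
  rw [← continuous_lift_iff]
  refine (LipschitzWith.of_dist_le_mul (K := ⟨L, hL⟩) fun y y' => ?_).continuous
  rw [Real.dist_eq, dist_eq_norm, lift_apply, lift_apply]
  exact hfL y y'

/-- **The improved Hölder inequality, `p`-th power form** (Modena–Székelyhidi 2018, Lemma 2.1,
upper half of `| ‖fg_λ‖^p_p - ‖f‖^p_p‖g‖^p_p | ≤ C_p λ⁻¹ ‖f‖^p_{C¹}‖g‖^p_p`; Luo–Titi 2020,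
Lemma 3): for `1 ≤ p`, `N ≥ 1`, `|f| ≤ M` with `L`-Lipschitz lift and `g` a.e.-strongly
measurable and `(1/N)ℤ^d`-invariant,
`∫_{T^d} |f|^p ‖g‖^p ≤ (∫ |f|^p + p M^{p-1} L √d/N) · ∫ ‖g‖^p`.
[cite: ModenaSzekelyhidi2018, §2.1 Lemma 2.1 (proof)] -/
theorem lintegral_rpow_smul_le_of_latticeInvariant (hN : 0 < N) (hp : 1 ≤ p) (hL : 0 ≤ L)
    (hfM : ∀ x, |f x| ≤ M)
    (hfL : ∀ y y' : EuclideanSpace ℝ d, |f (proj y) - f (proj y')| ≤ L * ‖y - y'‖)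
    (hg : AEStronglyMeasurable g volume)
    (hper : ∀ (x : UnitAddTorus d) (κ : d → Fin N), g (x + proj (cellCorner N κ)) = g x) :
    ∫⁻ x, ‖f x • g x‖ₑ ^ p ≤
      ((∫⁻ x, ‖f x‖ₑ ^ p) +
          ENNReal.ofReal (p * M ^ (p - 1) * L * (Real.sqrt (Fintype.card d) / N))) *
        ∫⁻ x, ‖g x‖ₑ ^ p := by
  have hp0 : 0 ≤ p := zero_le_one.trans hp
  set E := ENNReal.ofReal (p * M ^ (p - 1) * L * (Real.sqrt (Fintype.card d) / N)) with hE
  set V : ℝ≥0∞ := ENNReal.ofReal ((N : ℝ)⁻¹) ^ Fintype.card d with hV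
  set C : ℝ≥0∞ := (N : ℝ≥0∞) ^ Fintype.card d with hC
  have hCV : C * V = 1 := card_mul_volume_cell hN
  -- the three integrands on the lift
  set Φf : EuclideanSpace ℝ d → ℝ≥0∞ := fun y => ‖f (proj y)‖ₑ ^ p with hΦf
  set Φg : EuclideanSpace ℝ d → ℝ≥0∞ := fun y => ‖g (proj y)‖ₑ ^ p with hΦg
  have hfc : Continuous f := continuous_of_lipschitz_lift hL hfL
  have hfmeas : AEMeasurable (fun x => ‖f x‖ₑ ^ p) volume :=
    (hfc.measurable.enorm.pow_const p).aemeasurable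
  have hgmeas : AEMeasurable (fun x => ‖g x‖ₑ ^ p) volume := hg.enorm.pow_const p
  have hprod : ∀ x, ‖f x • g x‖ₑ ^ p = ‖f x‖ₑ ^ p * ‖g x‖ₑ ^ p := fun x => by
    rw [enorm_smul, ENNReal.mul_rpow_of_nonneg _ _ hp0]
  have hfgmeas : AEMeasurable (fun x => ‖f x‖ₑ ^ p * ‖g x‖ₑ ^ p) volume := hfmeas.mul hgmeas
  -- periodicity of `Φg` and the value of the cell integrals of `Φg`
  have hperΦ : ∀ (x : UnitAddTorus d) (κ : d → Fin N),
      (fun x => ‖g x‖ₑ ^ p) (x + proj (cellCorner N κ)) = (fun x => ‖g x‖ₑ ^ p) x :=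
    fun x κ => by simp only [hper]
  have hcellg : ∀ κ : d → Fin N,
      ∫⁻ y in latticeCell N (fun i => ((κ i : ℕ) : ℤ)), Φg y = V * ∫⁻ x, ‖g x‖ₑ ^ p := by
    intro κ
    have h := card_mul_setLIntegral_cell_eq_lintegral hN hgmeas hperΦ κ
    rw [← h, ← mul_assoc, mul_comm V C, hCV, one_mul]
  -- measurability of `Φg` on each cell
  have hmp := measurePreserving_proj_unitCube_holds (d := d)
  have hΦg_meas : ∀ κ : d → Fin N,
      AEMeasurable Φg (volume.restrict (latticeCell N (fun i => ((κ i : ℕ) : ℤ)))) := by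
    intro κ
    have h1 : AEStronglyMeasurable (g ∘ proj) (volume.restrict (unitCube d)) :=
      hg.comp_measurePreserving hmp
    have h2 : AEStronglyMeasurable (g ∘ proj)
        (volume.restrict (latticeCell N (fun i => ((κ i : ℕ) : ℤ)))) :=
      h1.mono_measure (Measure.restrict_mono (latticeCell_subset_unitCube hN κ) le_rfl)
    exact h2.enorm.pow_const p
  -- the cellwise estimate
  have hcell : ∀ κ : d → Fin N,
      ∫⁻ y in latticeCell N (fun i => ((κ i : ℕ) : ℤ)), Φf y * Φg y ≤
        ((∫⁻ y in latticeCell N (fun i => ((κ i : ℕ) : ℤ)), Φf y) + V * E) * ∫⁻ x, ‖g x‖ₑ ^ p := by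
    intro κ
    set Q := latticeCell (d := d) N (fun i => ((κ i : ℕ) : ℤ)) with hQ
    set S : ℝ≥0∞ := ⨆ y ∈ Q, Φf y with hS
    have hvolQ : volume Q = V := volume_latticeCell hN
    -- `∫_Q Φf Φg ≤ S ∫_Q Φg`
    have h1 : ∫⁻ y in Q, Φf y * Φg y ≤ S * ∫⁻ y in Q, Φg y := by
      rw [← lintegral_const_mul'' S (hΦg_meas κ)]
      exact setLIntegral_mono' measurableSet_latticeCell fun y hy =>
        mul_le_mul' (le_iSup₂ (f := fun y (_ : y ∈ Q) => Φf y) y hy) le_rfl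
    -- `V S ≤ ∫_Q Φf + V E`
    have h2 : V * S ≤ (∫⁻ y in Q, Φf y) + V * E := by
      rw [hS, ENNReal.mul_iSup]
      refine iSup_le fun y => ?_
      rw [ENNReal.mul_iSup]
      refine iSup_le fun hy => ?_
      rw [← hvolQ]
      exact volume_mul_enorm_rpow_le hN hp hL hfM hfL hy
    calc ∫⁻ y in Q, Φf y * Φg y ≤ S * ∫⁻ y in Q, Φg y := h1
      _ = S * (V * ∫⁻ x, ‖g x‖ₑ ^ p) := by rw [hcellg κ]
      _ = (V * S) * ∫⁻ x, ‖g x‖ₑ ^ p := by ring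
      _ ≤ ((∫⁻ y in Q, Φf y) + V * E) * ∫⁻ x, ‖g x‖ₑ ^ p := mul_le_mul' h2 le_rfl
  -- sum over the cells
  have hsumf : ∑ κ : d → Fin N, ∫⁻ y in latticeCell N (fun i => ((κ i : ℕ) : ℤ)), Φf y =
      ∫⁻ x, ‖f x‖ₑ ^ p := by
    rw [lintegral_eq_setLIntegral_unitCube_lift hfmeas, setLIntegral_unitCube_eq_sum_latticeCell hN]
  have hcard : (Finset.univ : Finset (d → Fin N)).card • (V * E) = E := by
    rw [Finset.card_univ, Fintype.card_fun, Fintype.card_fin, nsmul_eq_mul]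
    push_cast
    rw [← hC, ← mul_assoc, hCV, one_mul]
  calc ∫⁻ x, ‖f x • g x‖ₑ ^ p = ∫⁻ x, ‖f x‖ₑ ^ p * ‖g x‖ₑ ^ p := lintegral_congr hprod
    _ = ∑ κ : d → Fin N, ∫⁻ y in latticeCell N (fun i => ((κ i : ℕ) : ℤ)), Φf y * Φg y := by
        rw [lintegral_eq_setLIntegral_unitCube_lift hfgmeas,
          setLIntegral_unitCube_eq_sum_latticeCell hN]
    _ ≤ ∑ κ : d → Fin N,
          ((∫⁻ y in latticeCell N (fun i => ((κ i : ℕ) : ℤ)), Φf y) + V * E) * ∫⁻ x, ‖g x‖ₑ ^ p :=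
        Finset.sum_le_sum fun κ _ => hcell κ
    _ = ((∫⁻ x, ‖f x‖ₑ ^ p) + E) * ∫⁻ x, ‖g x‖ₑ ^ p := by
        rw [← Finset.sum_mul, Finset.sum_add_distrib, hsumf, Finset.sum_const, hcard]

/-- **The improved Hölder inequality (`L^p` decorrelation) on `T^d`** — Modena–Székelyhidi
2018, Lemma 2.1 (upper inequality (2.4)); Luo–Titi 2020, Lemma 3; cf. Buckmaster–Vicol 2019,
Lemma 3.7. For a finite exponent `1 ≤ p`, an integer `N ≥ 1`, `g : T^d → F` a.e.-strongly
measurable and `(𝕋/N)^d`-periodic (invariant under `x ↦ x + κ/N`, `κ ∈ ℤ^d`), and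
`f : T^d → ℝ` with `|f| ≤ M` and `L`-Lipschitz lift:
`‖f g‖_{L^p} ≤ ‖f‖_{L^p} ‖g‖_{L^p} + (p M^{p-1} L √d / N)^{1/p} ‖g‖_{L^p}`.
[cite: ModenaSzekelyhidi2018, §2.1 Lemma 2.1] -/
theorem eLpNorm_smul_le_of_latticeInvariant (hN : 0 < N) (hp : 1 ≤ p) (hL : 0 ≤ L)
    (hfM : ∀ x, |f x| ≤ M)
    (hfL : ∀ y y' : EuclideanSpace ℝ d, |f (proj y) - f (proj y')| ≤ L * ‖y - y'‖)
    (hg : AEStronglyMeasurable g volume)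
    (hper : ∀ (x : UnitAddTorus d) (κ : d → Fin N), g (x + proj (cellCorner N κ)) = g x) :
    eLpNorm (fun x => f x • g x) (ENNReal.ofReal p) volume ≤
      eLpNorm f (ENNReal.ofReal p) volume * eLpNorm g (ENNReal.ofReal p) volume +
        ENNReal.ofReal ((p * M ^ (p - 1) * L * (Real.sqrt (Fintype.card d) / N)) ^ (1 / p)) *
          eLpNorm g (ENNReal.ofReal p) volume := by
  have hp0 : 0 < p := zero_lt_one.trans_le hp
  have hM : 0 ≤ M := (abs_nonneg _).trans (hfM 0)
  have hpne : ENNReal.ofReal p ≠ 0 := by simpa using hp0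
  have htop : ENNReal.ofReal p ≠ ∞ := ENNReal.ofReal_ne_top
  have hq0 : 0 ≤ 1 / p := by positivity
  have hq1 : 1 / p ≤ 1 := by rw [div_le_one hp0]; exact hp
  simp only [eLpNorm_eq_lintegral_rpow_enorm_toReal hpne htop, ENNReal.toReal_ofReal hp0.le]
  have h := lintegral_rpow_smul_le_of_latticeInvariant hN hp hL hfM hfL hg hper
  set If := ∫⁻ x, ‖f x‖ₑ ^ p
  set Ig := ∫⁻ x, ‖g x‖ₑ ^ p
  set e : ℝ := p * M ^ (p - 1) * L * (Real.sqrt (Fintype.card d) / N)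
  have he : 0 ≤ e := by positivity
  calc (∫⁻ x, ‖f x • g x‖ₑ ^ p) ^ (1 / p)
      ≤ ((If + ENNReal.ofReal e) * Ig) ^ (1 / p) := ENNReal.rpow_le_rpow h hq0
    _ = (If * Ig + ENNReal.ofReal e * Ig) ^ (1 / p) := by rw [add_mul]
    _ ≤ (If * Ig) ^ (1 / p) + (ENNReal.ofReal e * Ig) ^ (1 / p) := ENNReal.rpow_add_le_add_rpow _ _ hq0 hq1
    _ = If ^ (1 / p) * Ig ^ (1 / p) + ENNReal.ofReal (e ^ (1 / p)) * Ig ^ (1 / p) := by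
        rw [ENNReal.mul_rpow_of_nonneg _ _ hq0, ENNReal.mul_rpow_of_nonneg _ _ hq0,
          ENNReal.ofReal_rpow_of_nonneg he hq0]

/-- **The improved Hölder inequality in the printed shape** `‖fg‖_{L^p} ≤ ‖f‖_{L^p}‖g‖_{L^p} +
C_p N^{-1/p} ‖f‖_{C¹} ‖g‖_{L^p}`: with `C_p = (p √d)^{1/p}` and any `K` dominating the sup
bound `M` and the Lipschitz constant `L` of `f` (e.g. `K = ‖f‖_{C¹} = ‖f‖_{C⁰} + ‖∇f‖_{C⁰}`).
[cite: LuoTiti2020, §3.4 Lemma 3] -/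
theorem eLpNorm_smul_le_of_latticeInvariant' (hN : 0 < N) (hp : 1 ≤ p) (hL : 0 ≤ L) {K : ℝ}
    (hMK : M ≤ K) (hLK : L ≤ K) (hfM : ∀ x, |f x| ≤ M)
    (hfL : ∀ y y' : EuclideanSpace ℝ d, |f (proj y) - f (proj y')| ≤ L * ‖y - y'‖)
    (hg : AEStronglyMeasurable g volume)
    (hper : ∀ (x : UnitAddTorus d) (κ : d → Fin N), g (x + proj (cellCorner N κ)) = g x) :
    eLpNorm (fun x => f x • g x) (ENNReal.ofReal p) volume ≤
      eLpNorm f (ENNReal.ofReal p) volume * eLpNorm g (ENNReal.ofReal p) volume +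
        ENNReal.ofReal ((p * Real.sqrt (Fintype.card d)) ^ (1 / p) * (N : ℝ) ^ (-(1 / p)) * K) *
          eLpNorm g (ENNReal.ofReal p) volume := by
  have hp0 : 0 < p := zero_lt_one.trans_le hp
  have hM : 0 ≤ M := (abs_nonneg _).trans (hfM 0)
  have hK : 0 ≤ K := hM.trans hMK
  have hN' : (0 : ℝ) < N := by exact_mod_cast hN
  refine (eLpNorm_smul_le_of_latticeInvariant hN hp hL hfM hfL hg hper).trans ?_
  gcongr
  -- `(p M^{p-1} L √d / N)^{1/p} ≤ (p √d)^{1/p} N^{-1/p} K`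
  have h1 : p * M ^ (p - 1) * L * (Real.sqrt (Fintype.card d) / N) ≤
      p * Real.sqrt (Fintype.card d) * (N : ℝ)⁻¹ * K ^ p := by
    have hMp : M ^ (p - 1) ≤ K ^ (p - 1) := Real.rpow_le_rpow hM hMK (by linarith)
    have hKp : K ^ (p - 1) * K = K ^ p := by
      rw [← Real.rpow_add_one' hK (by linarith), sub_add_cancel]
    calc p * M ^ (p - 1) * L * (Real.sqrt (Fintype.card d) / N)
        = p * Real.sqrt (Fintype.card d) * (N : ℝ)⁻¹ * (M ^ (p - 1) * L) := by ring
      _ ≤ p * Real.sqrt (Fintype.card d) * (N : ℝ)⁻¹ * (K ^ (p - 1) * K) :=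
          mul_le_mul_of_nonneg_left (mul_le_mul hMp hLK hL (Real.rpow_nonneg hK _)) (by positivity)
      _ = p * Real.sqrt (Fintype.card d) * (N : ℝ)⁻¹ * K ^ p := by rw [hKp]
  have h2 : (p * M ^ (p - 1) * L * (Real.sqrt (Fintype.card d) / N)) ^ (1 / p) ≤
      (p * Real.sqrt (Fintype.card d) * (N : ℝ)⁻¹ * K ^ p) ^ (1 / p) :=
    Real.rpow_le_rpow (by positivity) h1 (by positivity)
  refine h2.trans (le_of_eq ?_)
  rw [Real.mul_rpow (by positivity) (Real.rpow_nonneg hK _),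
    Real.mul_rpow (by positivity) (by positivity), ← Real.rpow_mul hK,
    mul_one_div_cancel hp0.ne', Real.rpow_one, Real.rpow_neg hN'.le, Real.inv_rpow hN'.le]

end Main

end Torus

end Literature.Analysis.FunctionSpaces
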